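import Mathlib.RingTheory.AlgebraicIndependent.TranscendenceBasis
import Mathlib.RingTheory.Algebraic.Integral
import Mathlib.Algebra.MvPolynomial.Equiv
import HarnessLib

/-!
# Transcendence bookkeeping for the fibration principle

Zilber's Exponential-Algebraic Closedness, case ladder (host summit Schanuel, cell `pub-schanuel`,
seat 2, gen 5).  Two field-theoretic facts feed the fibre lemma of `ZilberEacFibreAlgebra.lean`
(hypotheses (T) and (A) there), stated for a field extension `K / F` of transcendence degree `r + 1`,
a set `S ⊆ K` of "rank `r`" (an algebraically independent `r`-family `b` inside `S` over whose
`F`-algebra every element of `S` is algebraic), and two further elements `u, v` such that `K` is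
algebraic over `F[S, u, v]` (later: `K` = function field of an irreducible `(r+1)`-fold `W`, `S` = the
coordinate functions other than `x_last, y_last`, `{u, v} = {x_last, y_last}`):

* `transcendental_or_transcendental` — one of `u, v` is transcendental over `F[S]`;
* `isAlgebraic_insert_of_transcendental` — if `u` is transcendental over `F[S]` then `v` is
  algebraic over `F[S, u]`.

(Both by counting algebraically independent elements against `trdeg_F K = r + 1`.)  Then the
dictionary to polynomial coefficients (`S = range s̄`, `s̄ : τ → K`):

* `coeff_eval_eq_zero_of_transcendental` — (T): if `u` is transcendental over `F[s̄]`, a polynomial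
  `h ∈ F[X_τ][U]` with `h(s̄, u) = 0` has `hᵢ(s̄) = 0` for every coefficient;
* `exists_relation_of_isAlgebraic` — (A): if `v` is algebraic over `F[s̄, u]` there is
  `G ∈ F[X_τ][U][V]` with `G(s̄, u, v) = 0` and some `Gᵢ(s̄, u) ≠ 0`.

Honest framing: folklore field theory; nothing about `EC(3,2)` (OPEN) or Schanuel's conjecture is
asserted here.
-/

noncomputable section

open Polynomial

set_option linter.dupNamespace false

universe u

namespace Summit.Schanuel.Schanuel.Theorems

variable {F : Type*} {K : Type u} [Field F] [Field K] [Algebra F K]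

/-! ## Counting against the transcendence degree -/

section Count

variable {ι : Type u}

/-- `range (o ↦ o.elim a b) = insert a (range b)`. [folklore] -/
theorem range_option_elim {α : Type*} (a : α) (b : ι → α) :
    Set.range (fun o : Option ι => o.elim a b) = insert a (Set.range b) := by
  ext x
  simp only [Set.mem_range, Set.mem_insert_iff]
  constructor
  · rintro ⟨_ | i, rfl⟩
    · exact Or.inl rfl
    · exact Or.inr ⟨i, rfl⟩
  · rintro (rfl | ⟨i, rfl⟩)
    · exact ⟨none, rfl⟩
    · exact ⟨some i, rfl⟩

/-- **Maximal independent families span**: if no element of `S ⊇ range b` can be adjoined to the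
algebraically independent family `b` keeping independence, then every element of `S` is algebraic
over `F[b]`. [folklore] -/
theorem isAlgebraic_of_maximal {b : ι → K} (hb : AlgebraicIndependent F b) {S : Set K}
    (hmax : ∀ a ∈ S, ¬ AlgebraicIndependent F (fun o : Option ι => o.elim a b)) :
    ∀ a ∈ S, IsAlgebraic (Algebra.adjoin F (Set.range b)) a := by
  intro a ha
  have h := hmax a ha
  rw [AlgebraicIndependent.option_iff] at h
  by_contra hna
  exact h ⟨hb, hna⟩

/-- **One of `u, v` is transcendental over `F[S]`.**  If `trdeg_F K = #ι + 1`, `b : ι → K` lies in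
`S` and every element of `S` is algebraic over `F[b]`, and `K` is algebraic over `F[S, u, v]`, then
`u` and `v` cannot both be algebraic over `F[S]` (else `K` would be algebraic over `F[b]`, of
transcendence degree `≤ #ι`). [folklore] -/
theorem transcendental_or_transcendental [Fintype ι] {b : ι → K} {S : Set K}
    (halg : ∀ a ∈ S, IsAlgebraic (Algebra.adjoin F (Set.range b)) a) (u v : K)
    (hK : Algebra.IsAlgebraic (Algebra.adjoin F (insert u (insert v S))) K)
    (hcard : Algebra.trdeg F K = Fintype.card ι + 1) :
    Transcendental (Algebra.adjoin F S) u ∨ Transcendental (Algebra.adjoin F S) v := by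
  by_contra h
  push Not at h
  obtain ⟨hu, hv⟩ := h
  rw [Transcendental, not_not] at hu hv
  -- everything in `S ∪ {u, v}` is algebraic over `F[b]`
  have hS : ∀ x ∈ S \ Set.range b, IsAlgebraic (Algebra.adjoin F (Set.range b)) x :=
    fun x hx => halg x hx.1
  have hall : ∀ x ∈ insert u (insert v S) \ Set.range b,
      IsAlgebraic (Algebra.adjoin F (Set.range b)) x := by
    rintro x ⟨hx, -⟩
    rcases hx with rfl | rfl | hx
    · exact hu.adjoin_of_forall_isAlgebraic hS
    · exact hv.adjoin_of_forall_isAlgebraic hS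
    · exact halg x hx
  haveI : Algebra.IsAlgebraic (Algebra.adjoin F (Set.range b)) K :=
    ⟨fun a => (hK.isAlgebraic a).adjoin_of_forall_isAlgebraic hall⟩
  have hle := Algebra.IsAlgebraic.trdeg_le_cardinalMk F (Set.range b) (A := K)
  have hrange : Cardinal.mk (Set.range b) ≤ Fintype.card ι := by
    calc Cardinal.mk (Set.range b) ≤ Cardinal.mk ι := Cardinal.mk_range_le
      _ = Fintype.card ι := Cardinal.mk_fintype ι
  rw [hcard] at hle
  have := hle.trans hrange
  norm_cast at this
  omega

/-- **The other one is then algebraic over `F[S, u]`.**  If `trdeg_F K = #ι + 1`, `b : ι → K` is an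
algebraically independent family inside `S`, `u` is transcendental over `F[S]` and `v` were
transcendental over `F[S, u]`, then `(b, u, v)` would be `#ι + 2` independent elements. [folklore] -/
theorem isAlgebraic_insert_of_transcendental [Fintype ι] {b : ι → K} (hb : AlgebraicIndependent F b)
    {S : Set K} (hbS : Set.range b ⊆ S) {u v : K} (hu : Transcendental (Algebra.adjoin F S) u)
    (hcard : Algebra.trdeg F K = Fintype.card ι + 1) :
    IsAlgebraic (Algebra.adjoin F (insert u S)) v := by
  by_contra hv
  change Transcendental _ v at hv
  -- `(b, u)` is independent
  have hb' : AlgebraicIndependent F (fun o : Option ι => o.elim u b) :=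
    AlgebraicIndependent.option_iff.2
      ⟨hb, hu.of_tower_top_of_subalgebra_le (Algebra.adjoin_mono hbS)⟩
  -- `(b, u, v)` is independent
  have hsub : Set.range (fun o : Option ι => o.elim u b) ⊆ insert u S := by
    rw [range_option_elim]; exact Set.insert_subset_insert hbS
  have hb'' : AlgebraicIndependent F (fun o : Option (Option ι) => o.elim v fun o => o.elim u b) :=
    AlgebraicIndependent.option_iff.2
      ⟨hb', hv.of_tower_top_of_subalgebra_le (Algebra.adjoin_mono hsub)⟩
  have hle := hb''.cardinalMk_le_trdeg
  rw [hcard, Cardinal.mk_fintype, Fintype.card_option, Fintype.card_option] at hle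
  norm_cast at hle
  omega

end Count

/-! ## From transcendence statements to polynomial coefficients -/

section Coeff

variable {τ : Type*} (s : τ → K)

/-- **Evaluation through `optionEquivLeft`**: for `q ∈ F[X_{Option τ}]`, evaluating the polynomial
`optionEquivLeft q ∈ F[X_τ][U]` by `X_τ ↦ s`, `U ↦ a` gives `q(a, s)` (the `aeval` version, into any
commutative `F`-algebra, of Mathlib's `optionEquivLeft_elim_eval`). [folklore] -/
theorem eval₂_optionEquivLeft {L : Type*} [CommRing L] [Algebra F L] (w : τ → L) (a : L)
    (q : MvPolynomial (Option τ) F) :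
    (Polynomial.eval₂RingHom (MvPolynomial.aeval (R := F) w : MvPolynomial τ F →+* L) a)
        (MvPolynomial.optionEquivLeft F τ q) =
      MvPolynomial.aeval (fun o : Option τ => o.elim a w) q := by
  have key : (Polynomial.eval₂RingHom (MvPolynomial.aeval (R := F) w : MvPolynomial τ F →+* L) a).comp
      (MvPolynomial.optionEquivLeft F τ : MvPolynomial (Option τ) F →+* _) =
      (MvPolynomial.aeval (R := F) (fun o : Option τ => o.elim a w) : MvPolynomial (Option τ) F →+* L) := by
    refine MvPolynomial.ringHom_ext (fun c => ?_) (fun o => ?_)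
    · rw [RingHom.comp_apply, RingHom.coe_coe, RingHom.coe_coe, MvPolynomial.optionEquivLeft_C,
        Polynomial.coe_eval₂RingHom, Polynomial.eval₂_C, RingHom.coe_coe, MvPolynomial.aeval_C,
        MvPolynomial.aeval_C]
    · rcases o with _ | t
      · rw [RingHom.comp_apply, RingHom.coe_coe, RingHom.coe_coe,
          MvPolynomial.optionEquivLeft_X_none, Polynomial.coe_eval₂RingHom, Polynomial.eval₂_X,
          MvPolynomial.aeval_X, Option.elim_none]
      · rw [RingHom.comp_apply, RingHom.coe_coe, RingHom.coe_coe,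
          MvPolynomial.optionEquivLeft_X_some, Polynomial.coe_eval₂RingHom, Polynomial.eval₂_C,
          RingHom.coe_coe, MvPolynomial.aeval_X, MvPolynomial.aeval_X, Option.elim_some]
  exact DFunLike.congr_fun key q

/-- **(T) in coefficients.**  If `u` is transcendental over `F[range s]` and `h ∈ F[X_τ][U]` has
`h(s, u) = 0`, then every coefficient satisfies `hᵢ(s) = 0`. [folklore] -/
theorem coeff_eval_eq_zero_of_transcendental {u : K}
    (hu : Transcendental (Algebra.adjoin F (Set.range s)) u) (h : Polynomial (MvPolynomial τ F))
    (hh : (Polynomial.eval₂RingHom (MvPolynomial.aeval (R := F) s : MvPolynomial τ F →+* K) u) h = 0)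
    (i : ℕ) : MvPolynomial.aeval s (h.coeff i) = 0 := by
  set B := Algebra.adjoin F (Set.range s) with hB
  -- the coefficient map `F[X_τ] → B`
  have hmem : ∀ q : MvPolynomial τ F, MvPolynomial.aeval s q ∈ B := fun q => by
    rw [hB, Algebra.adjoin_range_eq_range_aeval]; exact ⟨q, rfl⟩
  let φ : MvPolynomial τ F →+* B := (MvPolynomial.aeval s : MvPolynomial τ F →ₐ[F] K).toRingHom.codRestrict
    B.toSubring.toSubsemiring hmem
  have hφ : (algebraMap B K).comp φ = (MvPolynomial.aeval (R := F) s : MvPolynomial τ F →+* K) :=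
    RingHom.ext fun q => rfl
  have hzero : Polynomial.aeval u (h.map φ) = 0 := by
    rw [Polynomial.aeval_def, Polynomial.eval₂_map, hφ]
    exact hh
  have hmap : h.map φ = 0 := (transcendental_iff.1 hu) _ hzero
  have hci : φ (h.coeff i) = 0 := by rw [← Polynomial.coeff_map, hmap, Polynomial.coeff_zero]
  calc MvPolynomial.aeval s (h.coeff i) = ((φ (h.coeff i) : B) : K) := rfl
    _ = 0 := by rw [hci, Subalgebra.coe_zero]

/-- **(A) in coefficients.**  If `v` is algebraic over `F[range s, u]` then some
`G ∈ F[X_τ][U][V]` has `G(s, u, v) = 0` while `Gᵢ(s, u) ≠ 0` for one of its `V`-coefficients.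
[folklore] -/
theorem exists_relation_of_isAlgebraic {u v : K}
    (hv : IsAlgebraic (Algebra.adjoin F (insert u (Set.range s))) v) :
    ∃ G : Polynomial (Polynomial (MvPolynomial τ F)),
      (Polynomial.eval₂RingHom
          (Polynomial.eval₂RingHom (MvPolynomial.aeval (R := F) s : MvPolynomial τ F →+* K) u) v) G = 0 ∧
      ∃ i, (Polynomial.eval₂RingHom (MvPolynomial.aeval (R := F) s : MvPolynomial τ F →+* K) u)
          (G.coeff i) ≠ 0 := by
  -- `F[range s, u]` is the range of evaluation at `s' = (u, s)`
  set s' : Option τ → K := fun o => o.elim u s with hs'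
  set B := Algebra.adjoin F (insert u (Set.range s)) with hB
  have hBr : B = (MvPolynomial.aeval s').range := by
    rw [hB, ← Algebra.adjoin_range_eq_range_aeval, hs', range_option_elim]
  have hmem : ∀ q : MvPolynomial (Option τ) F, MvPolynomial.aeval s' q ∈ B := fun q => by
    rw [hBr]; exact ⟨q, rfl⟩
  let φ : MvPolynomial (Option τ) F →+* B :=
    (MvPolynomial.aeval s' : MvPolynomial (Option τ) F →ₐ[F] K).toRingHom.codRestrict
      B.toSubring.toSubsemiring hmem
  have hφsurj : Function.Surjective φ := by
    rintro ⟨x, hx⟩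
    rw [hBr] at hx
    obtain ⟨q, rfl⟩ := hx
    exact ⟨q, rfl⟩
  have hφ : (algebraMap B K).comp φ = (MvPolynomial.aeval (R := F) s' : MvPolynomial (Option τ) F →+* K) :=
    RingHom.ext fun q => rfl
  -- the evaluation `F[X_τ][U] → K` factors as `algebraMap B K ∘ φ ∘ optionEquivLeft⁻¹`
  set ev₂ := Polynomial.eval₂RingHom (MvPolynomial.aeval (R := F) s : MvPolynomial τ F →+* K) u with hev₂
  have hcomp : ev₂.comp (MvPolynomial.optionEquivLeft F τ : MvPolynomial (Option τ) F →+* _) =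
      (algebraMap B K).comp φ := by
    rw [hφ]
    refine RingHom.ext fun q => ?_
    rw [RingHom.comp_apply, hev₂]
    exact eval₂_optionEquivLeft s u q
  obtain ⟨p, hp0, hpv⟩ := hv
  obtain ⟨P, hP⟩ := Polynomial.map_surjective φ hφsurj p
  refine ⟨P.map (MvPolynomial.optionEquivLeft F τ : MvPolynomial (Option τ) F →+* _), ?_, ?_⟩
  · rw [Polynomial.coe_eval₂RingHom, Polynomial.eval₂_map, hcomp, ← Polynomial.eval₂_map, hP]
    exact hpv
  · obtain ⟨i, hi⟩ : ∃ i, p.coeff i ≠ 0 := by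
      by_contra hcon
      push Not at hcon
      exact hp0 (Polynomial.ext fun i => by rw [hcon i, Polynomial.coeff_zero])
    refine ⟨i, ?_⟩
    rw [Polynomial.coeff_map, ← RingHom.comp_apply, hcomp, RingHom.comp_apply]
    intro h
    apply hi
    rw [← hP, Polynomial.coeff_map]
    exact Subtype.ext h

end Coeff

end Summit.Schanuel.Schanuel.Theorems
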